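import Mathlib.Analysis.Convolution
import Mathlib.Analysis.Calculus.BumpFunction.Convolution
import Mathlib.Analysis.Calculus.BumpFunction.FiniteDimension
import Literature.Geometry.Lorentzian.WeakSolutionChart
import Literature.Geometry.Lorentzian.InverseMeanCurvatureFlowSemicontinuity
import HarnessLib

/-!
# Green's first identity against Lipschitz test functions:
# `∫_X w Δ_h f dμ_h = −∫_X h⁻¹(dw, df) dμ_h` for `w` locally Lipschitz with compact support

`GreenIdentityCompactSupport.lean` proves Green's first identity
`∫ w Δ_h f dμ_h = −∫ h⁻¹(dw, df) dμ_h` for `w ∈ C¹_c` and `f ∈ C²` on a Riemannian manifold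
without boundary. The variational theory of the inverse mean curvature flow (Huisken–Ilmanen,
J. Differential Geom. 59 (2001), §§1–3) tests smooth (regularised) solutions against competitors
which are only *locally Lipschitz* — e.g. the proof of the Smooth Flow Lemma 2.3 and of the
elliptic regularisation, Thm. 3.1, integrate `div(∇u/|∇u|)` resp. `div(∇u/√(|∇u|² + ε²))` against
`v − u` with `v ∈ C^{0,1}_loc` — so the identity is needed for `w` locally Lipschitz (for the
Riemannian distance, `IsLocLipschitzOn` of `InverseMeanCurvatureFlow.lean`) with compact support,
the differential `dw` being defined `μ_h`-a.e. (Rademacher). This file proves it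
(`integral_mul_dalembertian_eq_neg_integral_innerDual_of_isLocLipschitzOn`) by approximation:

* on `ℝⁿ`: a locally Lipschitz function with compact support is Lipschitz
  (`exists_lipschitzWith_of_locallyLipschitz_of_hasCompactSupport`); mollification by normalised
  bumps keeps the Lipschitz constant, localises the support and converges uniformly
  (`lipschitzWith_normed_convolution`, `exists_contDiff_lipschitzWith_tendstoUniformly`);
* in a chart: the zero extension of the pulled-back mollifications are `C¹_c` functions on `X`
  (`contMDiff_indicator_comp_extChartAt`, `WeakSolutionChart.lean`) to which the `C¹` identity
  applies; the left-hand sides converge by uniform convergence, the right-hand sides by the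
  weak-* convergence of gradients of equi-Lipschitz functions
  (`tendsto_integral_sum_mul_fderiv`, `InverseMeanCurvatureFlowWeakGradient.lean`) applied to the
  chart expression of `∫ h⁻¹(dw, df) dμ_h` (`integral_innerDual_eq_integral_chart`);
* globally: a smooth partition of unity on `tsupport w` and the a.e. Leibniz rule.

Everything is proved; there are no definitions and no named facts.

## References

* G. Huisken, T. Ilmanen, *The inverse mean curvature flow and the Riemannian Penrose
  inequality*, J. Differential Geom. 59 (2001) 353–437: proof of Lemma 2.3 and of Thm. 3.1
  (integration by parts against Lipschitz competitors).
* J. M. Lee, *Introduction to Riemannian Manifolds*, 2nd ed., Springer 2018, Problem 2-23 (a).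
* L. C. Evans, R. F. Gariepy, *Measure theory and fine properties of functions*, CRC 1992, §4.2
  (mollification of Lipschitz functions), §6.2.
-/

noncomputable section

open Bundle Set Function Filter Manifold MeasureTheory Metric
open scoped Manifold ContDiff Topology ENNReal NNReal Convolution Pointwise

namespace Literature.Geometry.Lorentzian

open PseudoRiemannianMetric

/-! ### Locally Lipschitz functions with compact support; mollification on `ℝⁿ` -/

section Euclidean

/-- **A locally Lipschitz function with compact support is Lipschitz** (Lebesgue number of a
finite cover of the support by sets on which the function is Lipschitz; far-apart points are
handled by the bound `2 sup|f| / δ`). [folklore] -/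
theorem exists_lipschitzWith_of_locallyLipschitz_of_hasCompactSupport {α : Type*}
    [PseudoMetricSpace α] {f : α → ℝ} (hf : LocallyLipschitz f) (hfc : HasCompactSupport f) :
    ∃ L : ℝ≥0, LipschitzWith L f := by
  -- a bound for `|f|`
  obtain ⟨B₁, hB₁⟩ := (hf.continuous.norm).bddAbove_range_of_hasCompactSupport hfc.norm
  set B : ℝ := max B₁ 0 with hBdef
  have hB0 : 0 ≤ B := le_max_right _ _
  have hB' : ∀ x, |f x| ≤ B := fun x ↦
    (by simpa [Real.norm_eq_abs] using hB₁ (mem_range_self x) : |f x| ≤ B₁).trans (le_max_left _ _)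
  -- local Lipschitz data and a finite subcover of the support
  choose K t ht hK using hf
  obtain ⟨T₀, -, hcov⟩ := hfc.isCompact.elim_nhds_subcover (fun x ↦ interior (t x))
    (fun x _ ↦ interior_mem_nhds.2 (ht x))
  -- a Lebesgue number of the cover
  obtain ⟨δ, hδ, hδcov⟩ := lebesgue_number_lemma_of_metric hfc.isCompact
    (c := fun i : T₀ ↦ interior (t i)) (fun i ↦ isOpen_interior) (by
      intro x hx
      obtain ⟨i, hi, hxi⟩ := mem_iUnion₂.1 (hcov hx)
      exact mem_iUnion.2 ⟨⟨i, hi⟩, hxi⟩)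
  -- the constant
  set Kmax : ℝ≥0 := T₀.sup K with hKmax
  set L : ℝ≥0 := max Kmax ⟨2 * B / δ, by positivity⟩ with hL
  refine ⟨L, LipschitzWith.of_dist_le_mul fun x y ↦ ?_⟩
  -- the key estimate when the first point lies in the support
  have key : ∀ x y, x ∈ tsupport f → dist (f x) (f y) ≤ L * dist x y := by
    intro x y hx
    obtain ⟨⟨i, hi⟩, hball⟩ := hδcov x hx
    by_cases hxy : dist x y < δ
    · have hxi : x ∈ t i := interior_subset (hball (mem_ball_self hδ))
      have hyi : y ∈ t i := interior_subset (hball (by rwa [mem_ball, dist_comm]))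
      calc dist (f x) (f y) ≤ K i * dist x y := (hK i).dist_le_mul x hxi y hyi
        _ ≤ L * dist x y := by
          gcongr
          calc (K i : ℝ) ≤ Kmax := by exact_mod_cast Finset.le_sup (f := K) hi
            _ ≤ L := by exact_mod_cast le_max_left _ _
    · have hxy : δ ≤ dist x y := not_lt.1 hxy
      have h2B : dist (f x) (f y) ≤ 2 * B := by
        rw [Real.dist_eq]
        calc |f x - f y| ≤ |f x| + |f y| := abs_sub _ _
          _ ≤ B + B := add_le_add (hB' x) (hB' y)
          _ = 2 * B := by ring
      calc dist (f x) (f y) ≤ 2 * B := h2B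
        _ = (2 * B / δ) * δ := by field_simp
        _ ≤ (2 * B / δ) * dist x y := by gcongr
        _ ≤ L * dist x y := by
          gcongr
          show (2 * B / δ) ≤ ((max Kmax ⟨2 * B / δ, _⟩ : ℝ≥0) : ℝ)
          exact_mod_cast le_max_right Kmax ⟨2 * B / δ, by positivity⟩
  by_cases hx : x ∈ tsupport f
  · exact key x y hx
  by_cases hy : y ∈ tsupport f
  · rw [dist_comm (f x), dist_comm x]; exact key y x hy
  · rw [image_eq_zero_of_notMem_tsupport hx, image_eq_zero_of_notMem_tsupport hy, dist_self]
    positivity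

variable {E : Type*} [NormedAddCommGroup E] [NormedSpace ℝ E] [FiniteDimensional ℝ E]
  [MeasurableSpace E] [BorelSpace E]

/-- **Mollification does not increase the Lipschitz constant**: for a normalised bump `φ` and an
`L`-Lipschitz `G`, `φ ⋆ G` is `L`-Lipschitz
(`(φ ⋆ G)(x) − (φ ⋆ G)(y) = ∫ φ(t) [G(x − t) − G(y − t)] dt`). [folklore] -/
theorem lipschitzWith_normed_convolution {μ : Measure E} [μ.IsAddHaarMeasure]
    (φ : ContDiffBump (0 : E)) {G : E → ℝ} {L : ℝ≥0} (hG : LipschitzWith L G) :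
    LipschitzWith L (φ.normed μ ⋆[ContinuousLinearMap.lsmul ℝ ℝ, μ] G) := by
  have hGi : LocallyIntegrable G μ := hG.continuous.locallyIntegrable
  have hex : ∀ x, ConvolutionExistsAt (φ.normed μ) G x (ContinuousLinearMap.lsmul ℝ ℝ) μ :=
    fun x ↦ φ.hasCompactSupport_normed.convolutionExists_left _ φ.continuous_normed hGi x
  refine LipschitzWith.of_dist_le_mul fun x y ↦ ?_
  have i1 : Integrable (fun t ↦ φ.normed μ t • G (x - t)) μ := hex x
  have i2 : Integrable (fun t ↦ φ.normed μ t • G (y - t)) μ := hex y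
  simp only [convolution_lsmul]
  rw [Real.dist_eq, ← integral_sub i1 i2]
  have hbound : ∀ t, ‖φ.normed μ t • G (x - t) - φ.normed μ t • G (y - t)‖ ≤
      (L * dist x y) * φ.normed μ t := by
    intro t
    rw [← smul_sub, norm_smul, Real.norm_of_nonneg (φ.nonneg_normed t), mul_comm]
    refine mul_le_mul_of_nonneg_right ?_ (φ.nonneg_normed t)
    have := hG.dist_le_mul (x - t) (y - t)
    rwa [Real.dist_eq, show dist (x - t) (y - t) = dist x y by simp [dist_eq_norm]] at this
  have hint : Integrable (fun t ↦ (L * dist x y) * φ.normed μ t) μ :=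
    φ.integrable_normed.const_mul _
  have h1 := norm_integral_le_of_norm_le hint (Eventually.of_forall hbound)
  rwa [integral_const_mul, φ.integral_normed, mul_one, Real.norm_eq_abs] at h1

omit [NormedSpace ℝ E] [FiniteDimensional ℝ E] [MeasurableSpace E] [BorelSpace E] in
/-- The support of a thickened set: `ball 0 r + K ⊆ cthickening d K` for `r ≤ d`. [folklore] -/
theorem ball_add_subset_cthickening {K : Set E} {r d : ℝ} (hrd : r ≤ d) :
    ball (0 : E) r + K ⊆ cthickening d K := by
  rw [ball_add_zero]
  exact (thickening_mono hrd K).trans (thickening_subset_cthickening d K)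

/-- **Smooth equi-Lipschitz approximation with support control.** An `L`-Lipschitz function `F`
with compact support inside the open set `O` is the uniform limit of `C^∞` functions `Fₙ`, all
`L`-Lipschitz and supported in a fixed compact subset `K₀` of `O` (mollification by normalised
bumps of radius `→ 0`; Evans–Gariepy 1992, §4.2, Thm. 1). [folklore] -/
theorem exists_contDiff_lipschitzWith_tendstoUniformly (μ : Measure E) [μ.IsAddHaarMeasure]
    {F : E → ℝ} {L : ℝ≥0} (hF : LipschitzWith L F) (hFc : HasCompactSupport F) {O : Set E}
    (hO : IsOpen O) (hFO : tsupport F ⊆ O) :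
    ∃ (Fn : ℕ → E → ℝ) (K₀ : Set E), IsCompact K₀ ∧ K₀ ⊆ O ∧ tsupport F ⊆ K₀ ∧
      (∀ n, ContDiff ℝ ((⊤ : ℕ∞) : WithTop ℕ∞) (Fn n)) ∧ (∀ n, HasCompactSupport (Fn n)) ∧
      (∀ n, tsupport (Fn n) ⊆ K₀) ∧ (∀ n, LipschitzWith L (Fn n)) ∧
      TendstoUniformly Fn F atTop := by
  -- a compact neighbourhood `K₀ = cthickening d (tsupport F) ⊆ O`
  obtain ⟨d, hd, hdO⟩ := hFc.isCompact.exists_cthickening_subset_open hO hFO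
  set K₀ := cthickening d (tsupport F) with hK₀
  have hK₀c : IsCompact K₀ := hFc.isCompact.cthickening
  -- bumps of radius `d / (n + 2)`
  have hr : ∀ n : ℕ, 0 < d / (n + 2) := fun n ↦ by positivity
  set ψ : ℕ → ContDiffBump (0 : E) := fun n ↦
    ⟨d / (n + 2) / 2, d / (n + 2), half_pos (hr n), half_lt_self (hr n)⟩ with hψ
  have hψr : ∀ n, (ψ n).rOut = d / (n + 2) := fun n ↦ rfl
  have hrd : ∀ n : ℕ, d / (n + 2) ≤ d := fun n ↦ by
    rw [div_le_iff₀ (by positivity)]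
    nlinarith [hd.le, (Nat.cast_nonneg n : (0 : ℝ) ≤ n)]
  set Fn : ℕ → E → ℝ := fun n ↦ (ψ n).normed μ ⋆[ContinuousLinearMap.lsmul ℝ ℝ, μ] F with hFn
  have hFi : LocallyIntegrable F μ := hF.continuous.locallyIntegrable
  -- supports
  have hsupp : ∀ n, tsupport (Fn n) ⊆ K₀ := by
    intro n
    refine closure_minimal ?_ hK₀c.isClosed
    refine (support_convolution_subset (L := ContinuousLinearMap.lsmul ℝ ℝ) (μ := μ)).trans ?_
    refine (add_subset_add (ψ n).support_normed_eq.subset (subset_tsupport F)).trans ?_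
    rw [hψr n]
    exact ball_add_subset_cthickening (hrd n)
  refine ⟨Fn, K₀, hK₀c, hdO, self_subset_cthickening _, fun n ↦ ?_, fun n ↦ ?_, hsupp,
    fun n ↦ lipschitzWith_normed_convolution (ψ n) hF, ?_⟩
  · exact (ψ n).hasCompactSupport_normed.contDiff_convolution_left _ (ψ n).contDiff_normed hFi
  · exact HasCompactSupport.of_support_subset_isCompact hK₀c ((subset_tsupport _).trans (hsupp n))
  · -- uniform convergence: `|Fₙ x - F x| ≤ L d / (n + 2)`
    rw [Metric.tendstoUniformly_iff]
    intro ε hε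
    have hlim : Tendsto (fun n : ℕ ↦ (L : ℝ) * (d / (n + 2))) atTop (𝓝 0) := by
      have h1 : Tendsto (fun n : ℕ ↦ d / ((n : ℝ) + 2)) atTop (𝓝 0) := by
        have := tendsto_const_div_atTop_nhds_zero_nat d
        refine Tendsto.congr' ?_ ((tendsto_add_atTop_iff_nat 2).2 this)
        filter_upwards with n
        push_cast
        rfl
      simpa using h1.const_mul (L : ℝ)
    filter_upwards [(tendsto_order.1 hlim).2 ε hε] with n hn x
    rw [dist_comm]
    refine lt_of_le_of_lt ?_ hn
    refine (ψ n).dist_normed_convolution_le hF.continuous.aestronglyMeasurable fun x' hx' ↦ ?_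
    rw [hψr n] at hx'
    calc dist (F x') (F x) ≤ L * dist x' x := hF.dist_le_mul x' x
      _ ≤ L * (d / (n + 2)) := by gcongr; exact (mem_ball.1 hx').le

end Euclidean

/-! ### Chart representatives of locally Lipschitz functions supported in a chart domain -/

section Chart

variable {X : Type*} [TopologicalSpace X] [ChartedSpace E3 X] [IsManifold (𝓡 3) ∞ X]
  (h : ContMDiffRiemannianMetric (𝓡 3) ∞ E3 (TangentSpace (𝓡 3) : X → Type _))
  [T2Space X] [LocallyCompactSpace X]

set_option backward.isDefEq.respectTransparency false in
/-- **Transfer of Lipschitz bounds to a fixed chart.** For `q` in the domain of the chart `φ` at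
`x` there are a neighbourhood `U ⊆ φ.source` of `q` and a constant `c` such that every function
`K`-Lipschitz (Riemannian distance) on `V ⊆ U` has a `(K c)`-Lipschitz representative `w ∘ φ⁻¹`
on `φ(V)` (`exists_nhds_riemannianEDist_le_and_edist_le` at the base point `q`). [folklore] -/
theorem exists_nhds_forall_lipschitzOnWith_chart_of_mem (x : X) {q : X}
    (hq : q ∈ (chartAt E3 x).source) :
    letI : RiemannianBundle (fun x : X ↦ TangentSpace (𝓡 3) x) :=
      ⟨h.toContinuousRiemannianMetric.toRiemannianMetric⟩
    letI : PseudoEMetricSpace X := .ofRiemannianMetric (𝓡 3) X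
    ∃ U ∈ 𝓝 q, U ⊆ (extChartAt (𝓡 3) x).source ∧ ∃ c : ℝ≥0,
      ∀ (w : X → ℝ) (K : ℝ≥0) (V : Set X), V ⊆ U → LipschitzOnWith K w V →
        LipschitzOnWith (K * c) (w ∘ (extChartAt (𝓡 3) x).symm) (extChartAt (𝓡 3) x '' V) := by
  letI : RiemannianBundle (fun x : X ↦ TangentSpace (𝓡 3) x) :=
    ⟨h.toContinuousRiemannianMetric.toRiemannianMetric⟩
  letI : PseudoEMetricSpace X := .ofRiemannianMetric (𝓡 3) X
  obtain ⟨A, hA⟩ := exists_norm_eq_norm_symmL (I := 𝓡 3) x q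
  obtain ⟨U₁, hU₁, hU₁src, hle, -⟩ := exists_nhds_riemannianEDist_le_and_edist_le (I := 𝓡 3) x q
    hq hA one_lt_two
  have hsrc : U₁ ⊆ (extChartAt (𝓡 3) x).source := by rw [extChartAt_source]; exact hU₁src
  refine ⟨U₁, hU₁, hsrc, 2 * ‖A‖₊, ?_⟩
  intro w K V hVU hw
  rintro _ ⟨p, hp, rfl⟩ _ ⟨p', hp', rfl⟩
  simp only [Function.comp_apply, (extChartAt (𝓡 3) x).left_inv (hsrc (hVU hp)),
    (extChartAt (𝓡 3) x).left_inv (hsrc (hVU hp'))]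
  calc edist (w p) (w p') ≤ K * edist p p' := hw hp hp'
    _ ≤ K * ((2 : ℝ≥0) * edist (A (extChartAt (𝓡 3) x p)) (A (extChartAt (𝓡 3) x p'))) := by
      gcongr
      exact hle p (hVU hp) p' (hVU hp')
    _ ≤ K * ((2 : ℝ≥0) * (‖A‖₊ * edist (extChartAt (𝓡 3) x p) (extChartAt (𝓡 3) x p'))) := by
      gcongr
      exact A.lipschitz.edist_le_mul _ _
    _ = (K * (2 * ‖A‖₊) : ℝ≥0) * edist (extChartAt (𝓡 3) x p) (extChartAt (𝓡 3) x p') := by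
      push_cast; ring

set_option backward.isDefEq.respectTransparency false in
/-- **The chart representative of a locally Lipschitz function supported in a chart domain is
Lipschitz.** If `w` is locally Lipschitz on `X` (Riemannian distance) with compact support inside
the domain of the chart `φ` at `x`, then `ŵ = 1_{φ.target} · (w ∘ φ⁻¹)` is Lipschitz on `ℝ³`, has
compact support, and `tsupport ŵ ⊆ φ(tsupport w)`. [folklore] -/
theorem exists_lipschitzWith_indicator_comp_symm (x : X) {w : X → ℝ} (hw : IsLocLipschitzOn h w univ)
    (hwc : HasCompactSupport w) (hsupp : tsupport w ⊆ (extChartAt (𝓡 3) x).source) :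
    (∃ L : ℝ≥0, LipschitzWith L
      ((extChartAt (𝓡 3) x).target.indicator (w ∘ (extChartAt (𝓡 3) x).symm))) ∧
    HasCompactSupport ((extChartAt (𝓡 3) x).target.indicator (w ∘ (extChartAt (𝓡 3) x).symm)) ∧
    tsupport ((extChartAt (𝓡 3) x).target.indicator (w ∘ (extChartAt (𝓡 3) x).symm)) ⊆
      extChartAt (𝓡 3) x '' tsupport w := by
  letI : RiemannianBundle (fun x : X ↦ TangentSpace (𝓡 3) x) :=
    ⟨h.toContinuousRiemannianMetric.toRiemannianMetric⟩
  letI : PseudoEMetricSpace X := .ofRiemannianMetric (𝓡 3) X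
  set F := (extChartAt (𝓡 3) x).target.indicator (w ∘ (extChartAt (𝓡 3) x).symm) with hF
  set K := extChartAt (𝓡 3) x '' tsupport w with hK
  have hKc : IsCompact K := hwc.isCompact.image_of_continuousOn ((continuousOn_extChartAt x).mono hsupp)
  have hKT : K ⊆ (extChartAt (𝓡 3) x).target := by
    rintro _ ⟨p, hp, rfl⟩; exact (extChartAt (𝓡 3) x).map_source (hsupp hp)
  have hFT : ∀ y ∈ (extChartAt (𝓡 3) x).target, F y = w ((extChartAt (𝓡 3) x).symm y) :=
    fun y hy ↦ by rw [hF, indicator_of_mem hy]; rfl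
  have hF0 : ∀ y ∉ K, F y = 0 := by
    intro y hyK
    by_cases hyT : y ∈ (extChartAt (𝓡 3) x).target
    · rw [hFT y hyT]
      exact image_eq_zero_of_notMem_tsupport fun hmem ↦ hyK
        ⟨_, hmem, (extChartAt (𝓡 3) x).right_inv hyT⟩
    · rw [hF, indicator_of_notMem hyT]
  have hsuppF : tsupport F ⊆ K :=
    closure_minimal (fun y hy ↦ by_contra fun hyK ↦ hy (hF0 y hyK)) hKc.isClosed
  have hFc : HasCompactSupport F :=
    HasCompactSupport.of_support_subset_isCompact hKc ((subset_tsupport F).trans hsuppF)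
  -- `F` is locally Lipschitz
  have hloc : LocallyLipschitz F := by
    intro y
    by_cases hyK : y ∈ K
    · -- near a point of `K ⊆ φ.target`: transfer the local Lipschitz bound of `w` at `φ⁻¹ y`
      have hyT := hKT hyK
      set q := (extChartAt (𝓡 3) x).symm y with hq
      have hqs : q ∈ (chartAt E3 x).source := by
        rw [← extChartAt_source (𝓡 3)]; exact (extChartAt (𝓡 3) x).map_target hyT
      obtain ⟨U, hU, hUs, c, hUc⟩ := exists_nhds_forall_lipschitzOnWith_chart_of_mem h x hqs
      obtain ⟨Kq, t, ht, hKq⟩ := (show LocallyLipschitzOn univ w from hw) (mem_univ q)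
      rw [nhdsWithin_univ] at ht
      set V := interior (U ∩ t) with hV
      have hVo : IsOpen V := isOpen_interior
      have hqV : q ∈ V := mem_interior_iff_mem_nhds.2 (inter_mem hU ht)
      have hVU : V ⊆ U := interior_subset.trans inter_subset_left
      have hVs : V ⊆ (extChartAt (𝓡 3) x).source := hVU.trans hUs
      have hL : LipschitzOnWith (Kq * c) (w ∘ (extChartAt (𝓡 3) x).symm) (extChartAt (𝓡 3) x '' V) :=
        hUc w Kq V hVU (hKq.mono (interior_subset.trans inter_subset_right))
      have hopen : IsOpen (extChartAt (𝓡 3) x '' V) := isOpen_image_extChartAt hVo hVs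
      have hyV : y ∈ extChartAt (𝓡 3) x '' V := ⟨q, hqV, (extChartAt (𝓡 3) x).right_inv hyT⟩
      refine ⟨Kq * c, extChartAt (𝓡 3) x '' V, hopen.mem_nhds hyV, ?_⟩
      have hsubT : extChartAt (𝓡 3) x '' V ⊆ (extChartAt (𝓡 3) x).target := by
        rintro _ ⟨p, hp, rfl⟩; exact (extChartAt (𝓡 3) x).map_source (hVs hp)
      intro a ha a' ha'
      rw [hFT a (hsubT ha), hFT a' (hsubT ha')]
      exact hL ha ha'
    · -- off `K`, `F = 0` near `y`
      refine ⟨0, Kᶜ, hKc.isClosed.isOpen_compl.mem_nhds hyK, ?_⟩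
      intro a ha a' ha'
      rw [hF0 a ha, hF0 a' ha', edist_self]
      exact zero_le
  exact ⟨exists_lipschitzWith_of_locallyLipschitz_of_hasCompactSupport hloc hFc, hFc, hsuppF⟩

variable [MeasurableSpace X] [BorelSpace X]

set_option backward.isDefEq.respectTransparency false in
/-- **`∫ h⁻¹(dw, df) dμ_h` in a chart.** For `w` with `tsupport w` inside the domain of the chart
`φ` at `x` and any `f`,
`∫_X h⁻¹(dw, df) dμ_h = ∫_{φ.target} √det(h_{ij}) ∑ₗ ∑ₖ hᵏˡ ∂ₖf̂ ∂ₗŵ dy` with `f̂ = f ∘ φ⁻¹`,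
`ŵ = w ∘ φ⁻¹` and `(hᵏˡ) ∘ φ⁻¹` the inverse Gram matrix of the coordinate frame
(`innerDual_eq_sum_localFrame`, `mfderiv_apply_localFrame`, `setIntegral_extChartAt_comp`). Valid
for *every* `w, f` (junk values `0` of `mfderiv` and `fderiv` correspond). [folklore] -/
theorem integral_innerDual_eq_integral_chart (x : X) {w : X → ℝ}
    (hsupp : tsupport w ⊆ (extChartAt (𝓡 3) x).source) (f : X → ℝ) :
    ∫ p, (ofRiemannian h).innerDual p (mvfderiv (𝓡 3) w p).toLinearMap
        (mvfderiv (𝓡 3) f p).toLinearMap ∂riemannianMeasure h =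
      ∫ y in (extChartAt (𝓡 3) x).target, Real.sqrt (chartGramMatrix h x y).det *
        ∑ l, ∑ k, (Matrix.of fun i j ↦ (ofRiemannian h).val ((extChartAt (𝓡 3) x).symm y)
          ((trivializationAt E3 (TangentSpace (𝓡 3)) x).localFrame
            (EuclideanSpace.basisFun (Fin 3) ℝ).toBasis i ((extChartAt (𝓡 3) x).symm y))
          ((trivializationAt E3 (TangentSpace (𝓡 3)) x).localFrame
            (EuclideanSpace.basisFun (Fin 3) ℝ).toBasis j ((extChartAt (𝓡 3) x).symm y)))⁻¹ k l *
        fderiv ℝ (f ∘ (extChartAt (𝓡 3) x).symm) y ((EuclideanSpace.basisFun (Fin 3) ℝ).toBasis k) *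
        fderiv ℝ (w ∘ (extChartAt (𝓡 3) x).symm) y ((EuclideanSpace.basisFun (Fin 3) ℝ).toBasis l) := by
  classical
  set b : Module.Basis (Fin 3) ℝ E3 := (EuclideanSpace.basisFun (Fin 3) ℝ).toBasis with hb
  set N : E3 → Matrix (Fin 3) (Fin 3) ℝ := fun y ↦ (Matrix.of fun i j ↦
    (ofRiemannian h).val ((extChartAt (𝓡 3) x).symm y)
      ((trivializationAt E3 (TangentSpace (𝓡 3)) x).localFrame b i ((extChartAt (𝓡 3) x).symm y))
      ((trivializationAt E3 (TangentSpace (𝓡 3)) x).localFrame b j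
        ((extChartAt (𝓡 3) x).symm y)))⁻¹ with hNdef
  have hsrc : (extChartAt (𝓡 3) x).source = (chartAt E3 x).source := extChartAt_source (𝓡 3) x
  have hNpull : ∀ p ∈ (extChartAt (𝓡 3) x).source, ∀ k l, N (extChartAt (𝓡 3) x p) k l =
      (Matrix.of fun i j ↦ (ofRiemannian h).val p
        ((trivializationAt E3 (TangentSpace (𝓡 3)) x).localFrame b i p)
        ((trivializationAt E3 (TangentSpace (𝓡 3)) x).localFrame b j p))⁻¹ k l := by
    intro p hp k l
    simp only [hNdef]
    rw [(extChartAt (𝓡 3) x).left_inv hp]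
  have hNc : ∀ k l, ContinuousOn (fun y ↦ N y k l) (extChartAt (𝓡 3) x).target := fun k l ↦
    continuousOn_gram_localFrame_inv_comp_symm h b x k l
  -- step 1: the integrand vanishes off the chart domain
  set Φ : X → ℝ := fun p ↦ (ofRiemannian h).innerDual p (mvfderiv (𝓡 3) w p).toLinearMap
    (mvfderiv (𝓡 3) f p).toLinearMap with hΦ
  have hΦ0 : ∀ p ∉ (extChartAt (𝓡 3) x).source, Φ p = 0 := fun p hp ↦ by
    simp only [hΦ, mvfderiv_eq_zero_of_notMem_tsupport (fun h' ↦ hp (hsupp h'))]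
    simp [PseudoRiemannianMetric.innerDual]
  have h1 : ∫ p, Φ p ∂riemannianMeasure h = ∫ p in (extChartAt (𝓡 3) x).source, Φ p ∂riemannianMeasure h :=
    (setIntegral_eq_integral_of_forall_compl_eq_zero fun p hp ↦ hΦ0 p hp).symm
  -- step 2: on the chart domain the integrand is `g ∘ φ`
  set g : E3 → ℝ := fun y ↦ ∑ l, ∑ k, N y k l *
    fderiv ℝ (f ∘ (extChartAt (𝓡 3) x).symm) y (b k) *
    fderiv ℝ (w ∘ (extChartAt (𝓡 3) x).symm) y (b l) with hg
  have h2 : ∫ p in (extChartAt (𝓡 3) x).source, Φ p ∂riemannianMeasure h =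
      ∫ p in (extChartAt (𝓡 3) x).source, g (extChartAt (𝓡 3) x p) ∂riemannianMeasure h := by
    refine setIntegral_congr_fun (isOpen_extChartAt_source x).measurableSet fun p hp ↦ ?_
    have hp' : p ∈ (chartAt E3 x).source := hsrc ▸ hp
    simp only [hΦ, hg, innerDual_eq_sum_localFrame (ofRiemannian h) b hp']
    refine Finset.sum_congr rfl fun l _ ↦ Finset.sum_congr rfl fun k _ ↦ ?_
    rw [hNpull p hp k l, ← mfderiv_apply_localFrame b hp' k, ← mfderiv_apply_localFrame b hp' l]
    rfl
  -- step 3: change of variables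
  have hgm : AEStronglyMeasurable g ((volume : Measure E3).restrict (extChartAt (𝓡 3) x).target) :=
    (aemeasurable_restrict_sum_sum_mul_fderiv (μ := volume) (measurableSet_extChartAt_target x)
      hNc (⇑b) (f ∘ (extChartAt (𝓡 3) x).symm) (w ∘ (extChartAt (𝓡 3) x).symm)).aestronglyMeasurable
  rw [h1, h2, setIntegral_extChartAt_comp h x hgm]
  refine setIntegral_congr_fun (measurableSet_extChartAt_target x) fun y _ ↦ ?_
  simp only [smul_eq_mul, hg]
  rfl

variable [SecondCountableTopology X]

set_option backward.isDefEq.respectTransparency false in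
/-- **Integrability of `h⁻¹(dw, df)`** for `w` locally Lipschitz with compact support inside a chart
domain and `f ∈ C¹`: in the chart the integrand is bounded (`|∂ŵ| ≤ Lip ŵ`) with compact support.
[folklore] -/
theorem integrable_innerDual_of_isLocLipschitzOn (x : X) {w : X → ℝ}
    (hw : IsLocLipschitzOn h w univ) (hwc : HasCompactSupport w)
    (hsupp : tsupport w ⊆ (extChartAt (𝓡 3) x).source) {f : X → ℝ}
    (hf : ContMDiff (𝓡 3) 𝓘(ℝ, ℝ) 1 f) :
    Integrable (fun p ↦ (ofRiemannian h).innerDual p (mvfderiv (𝓡 3) w p).toLinearMap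
      (mvfderiv (𝓡 3) f p).toLinearMap) (riemannianMeasure h) := by
  classical
  haveI : IsFiniteMeasureOnCompacts (riemannianMeasure h) :=
    ⟨fun K hK ↦ riemannianVolume_lt_top_of_isCompact_holds h le_rfl hK⟩
  set b : Module.Basis (Fin 3) ℝ E3 := (EuclideanSpace.basisFun (Fin 3) ℝ).toBasis with hb
  set N : E3 → Matrix (Fin 3) (Fin 3) ℝ := fun y ↦ (Matrix.of fun i j ↦
    (ofRiemannian h).val ((extChartAt (𝓡 3) x).symm y)
      ((trivializationAt E3 (TangentSpace (𝓡 3)) x).localFrame b i ((extChartAt (𝓡 3) x).symm y))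
      ((trivializationAt E3 (TangentSpace (𝓡 3)) x).localFrame b j
        ((extChartAt (𝓡 3) x).symm y)))⁻¹ with hNdef
  have hsrc : (extChartAt (𝓡 3) x).source = (chartAt E3 x).source := extChartAt_source (𝓡 3) x
  have hT : IsOpen (extChartAt (𝓡 3) x).target := isOpen_extChartAt_target x
  have hNpull : ∀ p ∈ (extChartAt (𝓡 3) x).source, ∀ k l, N (extChartAt (𝓡 3) x p) k l =
      (Matrix.of fun i j ↦ (ofRiemannian h).val p
        ((trivializationAt E3 (TangentSpace (𝓡 3)) x).localFrame b i p)
        ((trivializationAt E3 (TangentSpace (𝓡 3)) x).localFrame b j p))⁻¹ k l := by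
    intro p hp k l
    simp only [hNdef]
    rw [(extChartAt (𝓡 3) x).left_inv hp]
  have hNc : ∀ k l, ContinuousOn (fun y ↦ N y k l) (extChartAt (𝓡 3) x).target := fun k l ↦
    continuousOn_gram_localFrame_inv_comp_symm h b x k l
  -- the chart representatives
  obtain ⟨⟨L, hL⟩, hFc, hsuppF⟩ := exists_lipschitzWith_indicator_comp_symm h x hw hwc hsupp
  set F := (extChartAt (𝓡 3) x).target.indicator (w ∘ (extChartAt (𝓡 3) x).symm) with hF
  set K := extChartAt (𝓡 3) x '' tsupport w with hK
  have hKc : IsCompact K := hwc.isCompact.image_of_continuousOn ((continuousOn_extChartAt x).mono hsupp)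
  have hKT : K ⊆ (extChartAt (𝓡 3) x).target := by
    rintro _ ⟨p, hp, rfl⟩; exact (extChartAt (𝓡 3) x).map_source (hsupp hp)
  set fh := f ∘ (extChartAt (𝓡 3) x).symm with hfh
  have hfh1 : ContDiffOn ℝ 1 fh (extChartAt (𝓡 3) x).target := contDiffOn_comp_extChartAt_symm hf
  have hdfh : ∀ k, ContinuousOn (fun y ↦ fderiv ℝ fh y (b k)) (extChartAt (𝓡 3) x).target := fun k ↦
    (hfh1.continuousOn_fderiv_of_isOpen hT le_rfl).clm_apply continuousOn_const
  -- `fderiv ŵ = fderiv F` on the target, and it vanishes off `K` and is bounded by `L`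
  have hFeq : EqOn (w ∘ (extChartAt (𝓡 3) x).symm) F (extChartAt (𝓡 3) x).target :=
    fun y hy ↦ by rw [hF, indicator_of_mem hy]
  have hdF : ∀ y ∈ (extChartAt (𝓡 3) x).target,
      fderiv ℝ (w ∘ (extChartAt (𝓡 3) x).symm) y = fderiv ℝ F y := fun y hy ↦
    (hFeq.eventuallyEq_of_mem (hT.mem_nhds hy)).fderiv_eq
  have hdF0 : ∀ y ∉ K, fderiv ℝ F y = 0 := fun y hy ↦
    fderiv_of_notMem_tsupport ℝ fun h' ↦ hy (hsuppF h')
  have hdFb : ∀ y l, |fderiv ℝ F y (b l)| ≤ L * ‖b l‖ := fun y l ↦ by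
    rw [← Real.norm_eq_abs]
    exact ((fderiv ℝ F y).le_opNorm (b l)).trans
      (mul_le_mul_of_nonneg_right (norm_fderiv_le_of_lipschitz ℝ hL) (norm_nonneg _))
  -- the chart-side integrand `g` and the density `ρ`
  set g : E3 → ℝ := fun y ↦ ∑ l, ∑ k, N y k l * fderiv ℝ fh y (b k) *
    fderiv ℝ (w ∘ (extChartAt (𝓡 3) x).symm) y (b l) with hg
  set ρ : E3 → ℝ := fun y ↦ Real.sqrt (chartGramMatrix h x y).det with hρ
  have hg0 : ∀ y ∈ (extChartAt (𝓡 3) x).target, y ∉ K → g y = 0 := by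
    intro y hy hyK
    simp only [hg, hdF y hy, hdF0 y hyK, zero_apply, mul_zero,
      Finset.sum_const_zero]
  -- bounds on `K`
  set Gb : E3 → ℝ := fun y ↦ ∑ l, ∑ k, |N y k l| * |fderiv ℝ fh y (b k)| * (L * ‖b l‖) with hGb
  have hGbc : ContinuousOn Gb (extChartAt (𝓡 3) x).target := by
    refine continuousOn_finsetSum _ fun l _ ↦ continuousOn_finsetSum _ fun k _ ↦ ?_
    exact (((hNc k l).abs).mul (hdfh k).abs).mul continuousOn_const
  obtain ⟨M₁, hM₁⟩ := hKc.exists_bound_of_continuousOn (hGbc.mono hKT)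
  obtain ⟨M₂, hM₂⟩ := hKc.exists_bound_of_continuousOn
    ((continuousOn_sqrt_det_chartGramMatrix h x).mono hKT)
  have hgb : ∀ y ∈ K, |g y| ≤ M₁ := by
    intro y hy
    have hyT := hKT hy
    have h1 : |g y| ≤ Gb y := by
      simp only [hg, hGb]
      refine (Finset.abs_sum_le_sum_abs _ _).trans (Finset.sum_le_sum fun l _ ↦ ?_)
      refine (Finset.abs_sum_le_sum_abs _ _).trans (Finset.sum_le_sum fun k _ ↦ ?_)
      rw [abs_mul, abs_mul, hdF y hyT]
      exact mul_le_mul_of_nonneg_left (hdFb y l) (by positivity)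
    exact h1.trans ((le_abs_self _).trans (by simpa [Real.norm_eq_abs] using hM₁ y hy))
  -- integrability of `ρ • g` on the target
  have hgm : AEStronglyMeasurable g ((volume : Measure E3).restrict (extChartAt (𝓡 3) x).target) :=
    (aemeasurable_restrict_sum_sum_mul_fderiv (μ := volume) (measurableSet_extChartAt_target x)
      hNc (⇑b) fh (w ∘ (extChartAt (𝓡 3) x).symm)).aestronglyMeasurable
  have hρgm : AEStronglyMeasurable (fun y ↦ ρ y • g y)
      ((volume : Measure E3).restrict (extChartAt (𝓡 3) x).target) :=
    (aestronglyMeasurable_sqrt_det_chartGramMatrix h x).smul hgm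
  have hInt : IntegrableOn (fun y ↦ ρ y • g y) (extChartAt (𝓡 3) x).target := by
    rw [IntegrableOn]
    have hind : Integrable ((extChartAt (𝓡 3) x).target.indicator fun y ↦ ρ y • g y) volume := by
      refine integrable_of_eq_zero_of_bound (μ := volume) hKc (fun y hy ↦ ?_) ?_ (M := M₂ * M₁)
        fun y hy ↦ ?_
      · by_cases hyT : y ∈ (extChartAt (𝓡 3) x).target
        · rw [indicator_of_mem hyT, hg0 y hyT hy, smul_zero]
        · rw [indicator_of_notMem hyT]
      · refine (hρgm.mono_set hKT).congr ?_
        filter_upwards [ae_restrict_mem hKc.measurableSet] with y hy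
        rw [indicator_of_mem (hKT hy)]
      · rw [indicator_of_mem (hKT hy), smul_eq_mul, abs_mul]
        have hρb : |ρ y| ≤ M₂ := by simpa [Real.norm_eq_abs] using hM₂ y hy
        exact mul_le_mul hρb (hgb y hy) (abs_nonneg _) ((abs_nonneg _).trans hρb)
    exact (integrable_indicator_iff (measurableSet_extChartAt_target x)).1 hind
  -- back to the manifold
  have hIsrc := (integrableOn_extChartAt_comp_iff h x hgm).2 hInt
  have hΦeq : ∀ p ∈ (extChartAt (𝓡 3) x).source, (ofRiemannian h).innerDual p
      (mvfderiv (𝓡 3) w p).toLinearMap (mvfderiv (𝓡 3) f p).toLinearMap =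
      g (extChartAt (𝓡 3) x p) := by
    intro p hp
    have hp' : p ∈ (chartAt E3 x).source := hsrc ▸ hp
    simp only [hg, innerDual_eq_sum_localFrame (ofRiemannian h) b hp']
    refine Finset.sum_congr rfl fun l _ ↦ Finset.sum_congr rfl fun k _ ↦ ?_
    rw [hNpull p hp k l, ← mfderiv_apply_localFrame b hp' k, ← mfderiv_apply_localFrame b hp' l]
    rfl
  have hIsrc' : IntegrableOn (fun p ↦ (ofRiemannian h).innerDual p (mvfderiv (𝓡 3) w p).toLinearMap
      (mvfderiv (𝓡 3) f p).toLinearMap) (extChartAt (𝓡 3) x).source (riemannianMeasure h) :=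
    hIsrc.congr_fun (fun p hp ↦ (hΦeq p hp).symm) (isOpen_extChartAt_source x).measurableSet
  refine (integrableOn_iff_integrable_of_support_subset fun p hp ↦ ?_).1 hIsrc'
  by_contra hps
  rw [mem_support] at hp
  apply hp
  simp only [mvfderiv_eq_zero_of_notMem_tsupport (fun h' ↦ hps (hsupp h'))]
  simp [PseudoRiemannianMetric.innerDual]

end Chart

/-! ### Green's identity for Lipschitz test functions supported in a chart domain -/

section ChartCase

variable {X : Type*} [TopologicalSpace X] [ChartedSpace E3 X] [IsManifold (𝓡 3) ∞ X]
  (h : ContMDiffRiemannianMetric (𝓡 3) ∞ E3 (TangentSpace (𝓡 3) : X → Type _))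
  [T2Space X] [LocallyCompactSpace X] [MeasurableSpace X] [BorelSpace X]
  [SecondCountableTopology X] [(ofRiemannian h).HasLeviCivita]

set_option backward.isDefEq.respectTransparency false in
/-- **Green's first identity for a locally Lipschitz test function supported in a chart domain.**
For `w` locally Lipschitz on `X` (Riemannian distance) with compact `tsupport w` inside the chart
domain of `x`, and `f ∈ C²(X)`: `∫_X w Δ_h f dμ_h = −∫_X h⁻¹(dw, df) dμ_h` (`dw` defined a.e.).
Proof by mollification in the chart: the zero extensions `wₙ` of the pulled-back mollifications
of `ŵ = w ∘ φ⁻¹` are `C¹_c` (`contMDiff_indicator_comp_extChartAt`) and satisfy the identity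
(`integral_mul_dalembertian_of_hasCompactSupport_of_tsupport_subset`); `wₙ → w` uniformly gives the
left-hand sides, and the weak-* convergence of the gradients of the equi-Lipschitz `ŵₙ → ŵ`
(`tendsto_integral_sum_mul_fderiv`) the right-hand sides, read in the chart
(`integral_innerDual_eq_integral_chart`). This is the integration by parts against Lipschitz
competitors of Huisken–Ilmanen's proofs of Lemma 2.3 and Thm. 3.1.
[cite: HuiskenIlmanenIMCF2001, §2 proof of Lemma 2.3] -/
theorem integral_mul_dalembertian_of_isLocLipschitzOn_of_tsupport_subset (x : X) {w f : X → ℝ}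
    (hw : IsLocLipschitzOn h w univ) (hwc : HasCompactSupport w)
    (hf : ContMDiff (𝓡 3) 𝓘(ℝ, ℝ) 2 f) (hsupp : tsupport w ⊆ (chartAt E3 x).source) :
    ∫ p, w p * (ofRiemannian h).dalembertian f p ∂riemannianMeasure h =
      -∫ p, (ofRiemannian h).innerDual p (mvfderiv (𝓡 3) w p).toLinearMap
        (mvfderiv (𝓡 3) f p).toLinearMap ∂riemannianMeasure h := by
  classical
  haveI : IsFiniteMeasureOnCompacts (riemannianMeasure h) :=
    ⟨fun K hK ↦ riemannianVolume_lt_top_of_isCompact_holds h le_rfl hK⟩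
  set μ := riemannianMeasure h with hμ
  set b : Module.Basis (Fin 3) ℝ E3 := (EuclideanSpace.basisFun (Fin 3) ℝ).toBasis with hb
  have hsrc : (chartAt E3 x).source = (extChartAt (𝓡 3) x).source :=
    (extChartAt_source (𝓡 3) x).symm
  have hsuppS : tsupport w ⊆ (extChartAt (𝓡 3) x).source := hsrc ▸ hsupp
  have hT : IsOpen (extChartAt (𝓡 3) x).target := isOpen_extChartAt_target x
  -- the Lipschitz chart representative `F` of `w` and its mollifications `Fn`
  obtain ⟨⟨L, hL⟩, hFc, hsuppF⟩ := exists_lipschitzWith_indicator_comp_symm h x hw hwc hsuppS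
  set F := (extChartAt (𝓡 3) x).target.indicator (w ∘ (extChartAt (𝓡 3) x).symm) with hF
  have hKT : extChartAt (𝓡 3) x '' tsupport w ⊆ (extChartAt (𝓡 3) x).target := by
    rintro _ ⟨p, hp, rfl⟩; exact (extChartAt (𝓡 3) x).map_source (hsuppS hp)
  have hFT : tsupport F ⊆ (extChartAt (𝓡 3) x).target := hsuppF.trans hKT
  have hFeq : EqOn (w ∘ (extChartAt (𝓡 3) x).symm) F (extChartAt (𝓡 3) x).target :=
    fun y hy ↦ by rw [hF, indicator_of_mem hy]
  obtain ⟨Fn, K₀, hK₀c, hK₀T, hFK₀, hFns, hFnc, hFnsupp, hFnlip, hunif⟩ :=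
    exists_contDiff_lipschitzWith_tendstoUniformly (volume : Measure E3) hL hFc hT hFT
  -- the `C¹_c` pull-backs `wn n` and Green's identity for them
  set wn : ℕ → X → ℝ := fun n ↦ (chartAt E3 x).source.indicator (Fn n ∘ extChartAt (𝓡 3) x)
    with hwn
  have hwn1 : ∀ n, ContMDiff (𝓡 3) 𝓘(ℝ, ℝ) 1 (wn n) := fun n ↦
    (contMDiff_indicator_comp_extChartAt (I := 𝓡 3) (n := ((⊤ : ℕ∞) : WithTop ℕ∞)) x
      (hFns n) (hFnc n) ((hFnsupp n).trans hK₀T)).of_le (by exact_mod_cast le_top)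
  have hwnc : ∀ n, HasCompactSupport (wn n) := fun n ↦
    hasCompactSupport_indicator_comp_extChartAt x (hFnc n) ((hFnsupp n).trans hK₀T)
  have hwnsupp : ∀ n, tsupport (wn n) ⊆ (chartAt E3 x).source := fun n ↦ by
    obtain ⟨h1, -, h3⟩ := tsupport_indicator_comp_extChartAt_subset (I := 𝓡 3) x (hFnc n)
      ((hFnsupp n).trans hK₀T)
    exact h1.trans h3
  have hGreen : ∀ n, ∫ p, wn n p * (ofRiemannian h).dalembertian f p ∂μ =
      -∫ p, (ofRiemannian h).innerDual p (mvfderiv (𝓡 3) (wn n) p).toLinearMap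
        (mvfderiv (𝓡 3) f p).toLinearMap ∂μ := fun n ↦
    integral_mul_dalembertian_of_hasCompactSupport_of_tsupport_subset h x (hwn1 n) (hwnc n) hf
      (hwnsupp n)
  -- values of `wn n` and `w`
  have hwn_src : ∀ n, ∀ p ∈ (chartAt E3 x).source, wn n p = Fn n (extChartAt (𝓡 3) x p) :=
    fun n p hp ↦ by simp only [hwn, indicator_of_mem hp, Function.comp_apply]
  have hwn_out : ∀ n, ∀ p ∉ (chartAt E3 x).source, wn n p = 0 := fun n p hp ↦ by
    simp only [hwn, indicator_of_notMem hp]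
  have hw_src : ∀ p ∈ (chartAt E3 x).source, w p = F (extChartAt (𝓡 3) x p) := by
    intro p hp
    have hp' : p ∈ (extChartAt (𝓡 3) x).source := hsrc ▸ hp
    rw [← hFeq ((extChartAt (𝓡 3) x).map_source hp'), Function.comp_apply,
      (extChartAt (𝓡 3) x).left_inv hp']
  have hw_out : ∀ p ∉ (chartAt E3 x).source, w p = 0 := fun p hp ↦
    image_eq_zero_of_notMem_tsupport fun h' ↦ hp (hsupp h')
  -- (A) the left-hand sides converge: dominated convergence on the compact `S₁`
  set S₁ := (extChartAt (𝓡 3) x).symm '' K₀ ∪ tsupport w with hS₁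
  have hS₁c : IsCompact S₁ :=
    (hK₀c.image_of_continuousOn ((continuousOn_extChartAt_symm x).mono hK₀T)).union hwc.isCompact
  have hwnS : ∀ n, ∀ p ∉ S₁, wn n p = 0 := by
    intro n p hp
    by_cases hps : p ∈ (chartAt E3 x).source
    · rw [hwn_src n p hps]
      by_contra hne
      have hK : extChartAt (𝓡 3) x p ∈ K₀ := hFnsupp n (subset_tsupport _ hne)
      exact hp (Or.inl ⟨_, hK, (extChartAt (𝓡 3) x).left_inv (hsrc ▸ hps)⟩)
    · exact hwn_out n p hps
  have hwS : ∀ p ∉ S₁, w p = 0 := fun p hp ↦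
    image_eq_zero_of_notMem_tsupport fun h' ↦ hp (Or.inr h')
  have hΔc : Continuous ((ofRiemannian h).dalembertian f) := continuous_dalembertian _ hf
  have hwcont : Continuous w := hw.continuous h
  have hclose : ∀ {ε : ℝ}, 0 < ε → ∀ᶠ n in atTop, ∀ p, |wn n p - w p| < ε := by
    intro ε hε
    filter_upwards [Metric.tendstoUniformly_iff.1 hunif ε hε] with n hn p
    by_cases hps : p ∈ (chartAt E3 x).source
    · rw [hwn_src n p hps, hw_src p hps, abs_sub_comm, ← Real.dist_eq]
      exact hn _
    · rw [hwn_out n p hps, hw_out p hps, sub_zero, abs_zero]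
      exact hε
  have hLHS : Tendsto (fun n ↦ ∫ p, wn n p * (ofRiemannian h).dalembertian f p ∂μ) atTop
      (𝓝 (∫ p, w p * (ofRiemannian h).dalembertian f p ∂μ)) := by
    refine tendsto_integral_filter_of_dominated_convergence
      (S₁.indicator fun p ↦ (|w p| + 1) * |(ofRiemannian h).dalembertian f p|) ?_ ?_ ?_ ?_
    · exact Eventually.of_forall fun n ↦ ((hwn1 n).continuous.mul hΔc).aestronglyMeasurable
    · filter_upwards [hclose one_pos] with n hn
      refine Eventually.of_forall fun p ↦ ?_
      by_cases hp : p ∈ S₁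
      · rw [indicator_of_mem hp, norm_mul, Real.norm_eq_abs, Real.norm_eq_abs]
        refine mul_le_mul_of_nonneg_right ?_ (abs_nonneg _)
        have := hn p
        have : |wn n p| ≤ |w p| + |wn n p - w p| := by
          calc |wn n p| = |w p + (wn n p - w p)| := by ring_nf
            _ ≤ |w p| + |wn n p - w p| := abs_add_le _ _
        linarith
      · rw [indicator_of_notMem hp, hwnS n p hp, zero_mul, norm_zero]
    · rw [integrable_indicator_iff hS₁c.measurableSet]
      exact ((hwcont.abs.add continuous_const).mul hΔc.abs).continuousOn.integrableOn_compact hS₁c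
    · refine Eventually.of_forall fun p ↦ ?_
      refine Tendsto.mul ?_ tendsto_const_nhds
      by_cases hps : p ∈ (chartAt E3 x).source
      · simp only [hwn_src _ p hps, hw_src p hps]
        exact hunif.tendsto_at _
      · simp only [hwn_out _ p hps, hw_out p hps]
        exact tendsto_const_nhds
  -- (B) the right-hand sides converge: weak-* convergence of gradients in the chart
  set N : E3 → Matrix (Fin 3) (Fin 3) ℝ := fun y ↦ (Matrix.of fun i j ↦
    (ofRiemannian h).val ((extChartAt (𝓡 3) x).symm y)
      ((trivializationAt E3 (TangentSpace (𝓡 3)) x).localFrame b i ((extChartAt (𝓡 3) x).symm y))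
      ((trivializationAt E3 (TangentSpace (𝓡 3)) x).localFrame b j
        ((extChartAt (𝓡 3) x).symm y)))⁻¹ with hNdef
  have hNc : ∀ k l, ContinuousOn (fun y ↦ N y k l) (extChartAt (𝓡 3) x).target := fun k l ↦
    continuousOn_gram_localFrame_inv_comp_symm h b x k l
  set fh := f ∘ (extChartAt (𝓡 3) x).symm with hfh
  have hfh1 : ContDiffOn ℝ 1 fh (extChartAt (𝓡 3) x).target :=
    contDiffOn_comp_extChartAt_symm (hf.of_le (by norm_num))
  have hdfh : ∀ k, ContinuousOn (fun y ↦ fderiv ℝ fh y (b k)) (extChartAt (𝓡 3) x).target := fun k ↦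
    (hfh1.continuousOn_fderiv_of_isOpen hT le_rfl).clm_apply continuousOn_const
  set ρ : E3 → ℝ := fun y ↦ Real.sqrt (chartGramMatrix h x y).det with hρ
  set G : Fin 3 → E3 → ℝ := fun l y ↦ ρ y * ∑ k, N y k l * fderiv ℝ fh y (b k) with hG
  have hGc : ∀ l, ContinuousOn (G l) (extChartAt (𝓡 3) x).target := fun l ↦
    (continuousOn_sqrt_det_chartGramMatrix h x).mul
      (continuousOn_finsetSum _ fun k _ ↦ (hNc k l).mul (hdfh k))
  have hGint : ∀ l, Integrable (K₀.indicator (G l)) (volume : Measure E3) := fun l ↦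
    (((hGc l).mono hK₀T).integrableOn_compact hK₀c).integrable_indicator hK₀c.measurableSet
  have hGK : ∀ l, ∀ y ∉ K₀, K₀.indicator (G l) y = 0 := fun l y hy ↦ indicator_of_notMem hy _
  -- the right-hand side read in the chart, for `wn n` and for `w`
  have hRHS_eq : ∀ {v : X → ℝ} {V : E3 → ℝ}, tsupport v ⊆ (extChartAt (𝓡 3) x).source →
      EqOn (v ∘ (extChartAt (𝓡 3) x).symm) V (extChartAt (𝓡 3) x).target → tsupport V ⊆ K₀ →
      ∫ p, (ofRiemannian h).innerDual p (mvfderiv (𝓡 3) v p).toLinearMap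
          (mvfderiv (𝓡 3) f p).toLinearMap ∂μ =
        ∫ y, ∑ l, K₀.indicator (G l) y * fderiv ℝ V y (b l) := by
    intro v V hv hV hVK
    rw [hμ, integral_innerDual_eq_integral_chart h x hv f,
      ← integral_indicator (measurableSet_extChartAt_target x)]
    refine integral_congr_ae (Eventually.of_forall fun y ↦ ?_)
    simp only
    by_cases hyT : y ∈ (extChartAt (𝓡 3) x).target
    · rw [indicator_of_mem hyT, (hV.eventuallyEq_of_mem (hT.mem_nhds hyT)).fderiv_eq]
      by_cases hyK : y ∈ K₀
      · simp only [indicator_of_mem hyK, hG, Finset.mul_sum, Finset.sum_mul]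
        refine Finset.sum_congr rfl fun l _ ↦ Finset.sum_congr rfl fun k _ ↦ ?_
        ring
      · have h0 : fderiv ℝ V y = 0 := fderiv_of_notMem_tsupport ℝ fun h' ↦ hyK (hVK h')
        simp only [indicator_of_notMem hyK, h0, zero_apply, mul_zero, Finset.sum_const_zero]
    · have hyK : y ∉ K₀ := fun h' ↦ hyT (hK₀T h')
      simp only [indicator_of_notMem hyT, indicator_of_notMem hyK, zero_mul, Finset.sum_const_zero]
  have hRn : ∀ n, ∫ p, (ofRiemannian h).innerDual p (mvfderiv (𝓡 3) (wn n) p).toLinearMap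
      (mvfderiv (𝓡 3) f p).toLinearMap ∂μ = ∫ y, ∑ l, K₀.indicator (G l) y * fderiv ℝ (Fn n) y (b l) :=
    fun n ↦ hRHS_eq (hsrc ▸ hwnsupp n)
      (fun y hy ↦ indicator_comp_extChartAt_symm_apply (I := 𝓡 3) x (Fn n) hy) (hFnsupp n)
  have hRw : ∫ p, (ofRiemannian h).innerDual p (mvfderiv (𝓡 3) w p).toLinearMap
      (mvfderiv (𝓡 3) f p).toLinearMap ∂μ = ∫ y, ∑ l, K₀.indicator (G l) y * fderiv ℝ F y (b l) :=
    hRHS_eq hsuppS hFeq hFK₀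
  have hconvE : TendstoLocallyUniformlyOn Fn F atTop univ :=
    (tendstoUniformlyOn_univ.2 hunif).tendstoLocallyUniformlyOn
  have hT2 := tendsto_integral_sum_mul_fderiv (μ := (volume : Measure E3)) isOpen_univ hK₀c
    (subset_univ _) hFnlip hL hconvE (⇑b) hGint hGK
  have hRHS : Tendsto (fun n ↦ -∫ p, (ofRiemannian h).innerDual p
      (mvfderiv (𝓡 3) (wn n) p).toLinearMap (mvfderiv (𝓡 3) f p).toLinearMap ∂μ) atTop
      (𝓝 (-∫ p, (ofRiemannian h).innerDual p (mvfderiv (𝓡 3) w p).toLinearMap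
        (mvfderiv (𝓡 3) f p).toLinearMap ∂μ)) := by
    simp_rw [hRn, hRw]
    exact hT2.neg
  -- (C) conclude
  have hfun : (fun n ↦ ∫ p, wn n p * (ofRiemannian h).dalembertian f p ∂μ) =
      fun n ↦ -∫ p, (ofRiemannian h).innerDual p (mvfderiv (𝓡 3) (wn n) p).toLinearMap
        (mvfderiv (𝓡 3) f p).toLinearMap ∂μ := funext hGreen
  rw [hfun] at hLHS
  exact tendsto_nhds_unique hLHS hRHS

end ChartCase

/-! ### Green's identity for Lipschitz test functions: the global statement -/

section Global

variable {X : Type*} [TopologicalSpace X] [ChartedSpace E3 X] [IsManifold (𝓡 3) ∞ X]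
  (h : ContMDiffRiemannianMetric (𝓡 3) ∞ E3 (TangentSpace (𝓡 3) : X → Type _))

omit [IsManifold (𝓡 3) ∞ X] in
set_option backward.isDefEq.respectTransparency false in
/-- **Leibniz rule, applied form**: `d(φ w)_p(v) = φ(p) dw_p(v) + w(p) dφ_p(v)` for `φ, w`
differentiable at `p`. [folklore] -/
theorem mvfderiv_mul_apply {φ w : X → ℝ} {p : X} (hφ : MDifferentiableAt (𝓡 3) 𝓘(ℝ, ℝ) φ p)
    (hw : MDifferentiableAt (𝓡 3) 𝓘(ℝ, ℝ) w p) (v : TangentSpace (𝓡 3) p) :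
    mvfderiv (𝓡 3) (fun q ↦ φ q * w q) p v = φ p * mvfderiv (𝓡 3) w p v + w p * mvfderiv (𝓡 3) φ p v := by
  have hmul := hφ.hasMFDerivAt.mul hw.hasMFDerivAt
  have hfun : (fun q ↦ φ q * w q) = φ * w := rfl
  rw [show mvfderiv (𝓡 3) (fun q ↦ φ q * w q) p v =
    ((by exact mfderiv (𝓡 3) 𝓘(ℝ, ℝ) (fun q ↦ φ q * w q) p : TangentSpace (𝓡 3) p →L[ℝ] ℝ)) v
    from rfl, hfun, hmul.mfderiv]
  have eφ : ((by exact mfderiv (𝓡 3) 𝓘(ℝ, ℝ) φ p : TangentSpace (𝓡 3) p →L[ℝ] ℝ)) v =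
      mvfderiv (𝓡 3) φ p v := rfl
  have ew : ((by exact mfderiv (𝓡 3) 𝓘(ℝ, ℝ) w p : TangentSpace (𝓡 3) p →L[ℝ] ℝ)) v =
      mvfderiv (𝓡 3) w p v := rfl
  simp only [add_apply, smul_apply, smul_eq_mul]
  rw [eφ, ew]

variable [T2Space X] [LocallyCompactSpace X] [MeasurableSpace X] [BorelSpace X]
  [SecondCountableTopology X] [(ofRiemannian h).HasLeviCivita]

set_option backward.isDefEq.respectTransparency false in
/-- **Green's first identity against locally Lipschitz test functions with compact support.**
Let `(X, h)` be a Riemannian `3`-manifold without boundary (Hausdorff, second countable, locally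
compact), `w : X → ℝ` locally Lipschitz for the Riemannian distance with compact support, and
`f ∈ C²(X)`. Then `∫_X w Δ_h f dμ_h = −∫_X h⁻¹(dw, df) dμ_h`, where `dw = mvfderiv w` is defined
`μ_h`-a.e. (Rademacher) and `h⁻¹` is the inverse metric on covectors. A finite smooth partition of
unity on `tsupport w` subordinate to chart domains reduces this to
`integral_mul_dalembertian_of_isLocLipschitzOn_of_tsupport_subset`, the differential of
`w = ∑ ρᵢ w` being `∑ d(ρᵢ w)` at every point of differentiability of `w` (Leibniz rule and
`∑ ρᵢ = 1` near the support). This is the integration by parts of Huisken–Ilmanen's proofs of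
Lemma 2.3 and Thm. 3.1 (J. Differential Geom. 59 (2001)), where smooth level-set solutions are
tested against locally Lipschitz competitors; Lee 2018, Problem 2-23 (a) for `w ∈ C¹`.
[cite: HuiskenIlmanenIMCF2001, §2 proof of Lemma 2.3] -/
theorem integral_mul_dalembertian_eq_neg_integral_innerDual_of_isLocLipschitzOn {w f : X → ℝ}
    (hw : IsLocLipschitzOn h w univ) (hwc : HasCompactSupport w)
    (hf : ContMDiff (𝓡 3) 𝓘(ℝ, ℝ) 2 f) :
    ∫ p, w p * (ofRiemannian h).dalembertian f p ∂riemannianMeasure h =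
      -∫ p, (ofRiemannian h).innerDual p (mvfderiv (𝓡 3) w p).toLinearMap
        (mvfderiv (𝓡 3) f p).toLinearMap ∂riemannianMeasure h := by
  classical
  haveI : IsFiniteMeasureOnCompacts (riemannianMeasure h) :=
    ⟨fun K hK ↦ riemannianVolume_lt_top_of_isCompact_holds h le_rfl hK⟩
  set μ := riemannianMeasure h with hμ
  have hwcont : Continuous w := hw.continuous h
  have hΔc : Continuous ((ofRiemannian h).dalembertian f) := continuous_dalembertian _ hf
  -- a smooth partition of unity on `tsupport w` subordinate to the chart domains
  obtain ⟨ρ, hρ⟩ := SmoothPartitionOfUnity.exists_isSubordinate (𝓡 3) (isClosed_tsupport w)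
    (fun x : X ↦ (chartAt E3 x).source) (fun x ↦ (chartAt E3 x).open_source)
    (fun y _ ↦ mem_iUnion.2 ⟨y, mem_chart_source E3 y⟩)
  have hfin : {i | (support (ρ i) ∩ tsupport w).Nonempty}.Finite :=
    ρ.locallyFinite.finite_nonempty_inter_compact hwc
  set I₀ := hfin.toFinset with hI₀
  clear_value I₀
  have hsumρ : ∀ p ∈ tsupport w, ∑ i ∈ I₀, ρ i p = 1 := by
    intro p hp
    have h1 : ∑ᶠ i, ρ i p = 1 := ρ.sum_eq_one hp
    have h2 : ∑ᶠ i, ρ i p = ∑ i ∈ I₀, ρ i p := by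
      refine finsum_eq_sum_of_support_subset _ fun i hi ↦ ?_
      rw [Finset.mem_coe, hI₀, Set.Finite.mem_toFinset]
      exact ⟨p, hi, hp⟩
    rw [← h2, h1]
  -- the pieces `ρ i w`
  have hρ1 : ∀ i, ContMDiff (𝓡 3) 𝓘(ℝ, ℝ) 1 (ρ i) := fun i ↦
    (ρ i).contMDiff.of_le (by exact_mod_cast le_top)
  have hwp_lip : ∀ i, IsLocLipschitzOn h (fun p ↦ ρ i p * w p) univ := fun i ↦
    (isLocLipschitzOn_of_contMDiff h (hρ1 i)).mul h hw
  have hwp_c : ∀ i, HasCompactSupport (fun p ↦ ρ i p * w p) := fun i ↦ hwc.mul_left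
  have hwp_supp : ∀ i, tsupport (fun p ↦ ρ i p * w p) ⊆ (chartAt E3 i).source := fun i ↦
    (tsupport_mul_subset_left (f := (ρ i : X → ℝ)) (g := w)).trans (hρ i)
  have hsum : ∀ p, w p = ∑ i ∈ I₀, ρ i p * w p := by
    intro p
    by_cases hp : p ∈ tsupport w
    · rw [← Finset.sum_mul, hsumρ p hp, one_mul]
    · rw [image_eq_zero_of_notMem_tsupport hp]
      simp only [mul_zero, Finset.sum_const_zero]
  -- the chart case for each piece
  have hpiece : ∀ i, ∫ p, ρ i p * w p * (ofRiemannian h).dalembertian f p ∂μ =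
      -∫ p, (ofRiemannian h).innerDual p (mvfderiv (𝓡 3) (fun p ↦ ρ i p * w p) p).toLinearMap
        (mvfderiv (𝓡 3) f p).toLinearMap ∂μ := fun i ↦
    integral_mul_dalembertian_of_isLocLipschitzOn_of_tsupport_subset h i (hwp_lip i) (hwp_c i) hf
      (hwp_supp i)
  -- integrability of the pieces
  have hIL : ∀ i, Integrable (fun p ↦ ρ i p * w p * (ofRiemannian h).dalembertian f p) μ := fun i ↦
    (((ρ i).contMDiff.continuous.mul hwcont).mul hΔc).integrable_of_hasCompactSupport
      ((hwp_c i).mul_right)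
  have hIR : ∀ i, Integrable (fun p ↦ (ofRiemannian h).innerDual p
      (mvfderiv (𝓡 3) (fun p ↦ ρ i p * w p) p).toLinearMap (mvfderiv (𝓡 3) f p).toLinearMap) μ :=
    fun i ↦ integrable_innerDual_of_isLocLipschitzOn h i (hwp_lip i) (hwp_c i)
      ((hwp_supp i).trans (extChartAt_source (𝓡 3) i).symm.subset) (hf.of_le (by norm_num))
  -- the left-hand side splits
  have hL : ∫ p, w p * (ofRiemannian h).dalembertian f p ∂μ =
      ∑ i ∈ I₀, ∫ p, ρ i p * w p * (ofRiemannian h).dalembertian f p ∂μ := by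
    rw [← integral_finsetSum _ fun i _ ↦ hIL i]
    refine integral_congr_ae (Eventually.of_forall fun p ↦ ?_)
    simp only
    rw [← Finset.sum_mul, ← hsum p]
  -- the right-hand side splits: `dw = ∑ d(ρ i w)` at every differentiability point of `w`
  have hR : ∫ p, (ofRiemannian h).innerDual p (mvfderiv (𝓡 3) w p).toLinearMap
      (mvfderiv (𝓡 3) f p).toLinearMap ∂μ =
      ∑ i ∈ I₀, ∫ p, (ofRiemannian h).innerDual p
        (mvfderiv (𝓡 3) (fun p ↦ ρ i p * w p) p).toLinearMap (mvfderiv (𝓡 3) f p).toLinearMap ∂μ := by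
    rw [← integral_finsetSum _ fun i _ ↦ hIR i]
    refine integral_congr_ae ?_
    filter_upwards [hw.ae_mdifferentiableAt h isOpen_univ] with p hp
    have hwd := hp (mem_univ p)
    simp only [PseudoRiemannianMetric.innerDual]
    set v := (ofRiemannian h).sharp p (mvfderiv (𝓡 3) f p).toLinearMap with hv
    change mvfderiv (𝓡 3) w p v = ∑ i ∈ I₀, mvfderiv (𝓡 3) (fun q ↦ ρ i q * w q) p v
    have hprod : ∀ i, mvfderiv (𝓡 3) (fun q ↦ ρ i q * w q) p v =
        ρ i p * mvfderiv (𝓡 3) w p v + w p * mvfderiv (𝓡 3) (ρ i) p v := fun i ↦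
      mvfderiv_mul_apply ((hρ1 i).mdifferentiableAt one_ne_zero) hwd v
    simp only [hprod, Finset.sum_add_distrib, ← Finset.sum_mul, ← Finset.mul_sum]
    by_cases hpw : p ∈ tsupport w
    · rw [hsumρ p hpw, one_mul]
      by_cases hw0 : w p = 0
      · rw [hw0, zero_mul, add_zero]
      · -- `∑ ρ i = 1` on the open set `support w ∋ p`, so `∑ dρ i = 0` at `p`
        have hopen : support w ∈ 𝓝 p :=
          (isOpen_compl_singleton.preimage hwcont).mem_nhds hw0
        have hev : (fun _ ↦ (1 : ℝ)) =ᶠ[𝓝 p] fun q ↦ ∑ i ∈ I₀, ρ i q := by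
          filter_upwards [hopen] with q hq
          exact (hsumρ q (subset_tsupport _ hq)).symm
        have hS := (mvfderiv_finset_sum (I := 𝓡 3) I₀ (F := fun i q ↦ ρ i q) (p := p)
          fun i _ ↦ (hρ1 i).mdifferentiableAt one_ne_zero).2
        have hd0 : mvfderiv (𝓡 3) (fun q ↦ ∑ i ∈ I₀, ρ i q) p = 0 := by
          have h0 : HasMFDerivAt (𝓡 3) 𝓘(ℝ, ℝ) (fun q ↦ ∑ i ∈ I₀, ρ i q) p
              (0 : TangentSpace (𝓡 3) p →L[ℝ] ℝ) :=
            (hasMFDerivAt_const (1 : ℝ) p).congr_of_eventuallyEq hev.symm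
          exact h0.mfderiv
        have hsum0 : ∑ i ∈ I₀, mvfderiv (𝓡 3) (ρ i) p v = 0 := by
          have h1 : (∑ i ∈ I₀, mvfderiv (𝓡 3) (fun q ↦ ρ i q) p) v = 0 := by
            rw [← hS, hd0, zero_apply]
          rw [FunLike.coe_sum, Finset.sum_apply] at h1
          exact h1
        rw [hsum0, mul_zero, add_zero]
    · have hw0 : w p = 0 := image_eq_zero_of_notMem_tsupport hpw
      have hdw : mvfderiv (𝓡 3) w p = 0 := mvfderiv_eq_zero_of_notMem_tsupport hpw
      simp only [hw0, hdw, zero_mul, add_zero, zero_apply, mul_zero]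
  -- assemble
  rw [hL, hR, ← Finset.sum_neg_distrib]
  exact Finset.sum_congr rfl fun i _ ↦ hpiece i

end Global





end Literature.Geometry.Lorentzian

end
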